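import Literature.Geometry.Lorentzian.EndCompactification
import Literature.Geometry.Manifold.FlatTorus
import HarnessLib

/-!
# The asymptotically flat end of a punctured `3`-manifold; `T³ ∖ {p}` is one-ended

Let `M` be a Hausdorff `3`-manifold modelled on `E3 = ℝ³` and `p ∈ M`. In the chart `φ` of `M` at
`p`, the punctured coordinate ball `0 < |φ x − φ p| < ρ/2` is carried by the **inversion**
`v ↦ v/|v|²` (Mathlib's `EuclideanGeometry.inversion 0 1`; API in `EndCompactification.lean`) onto
the exterior region `{w : ℝ³ | 2/ρ < |w|}` — the "inverted coordinates" structure of infinity of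
`M ∖ {p}` (Lee–Parker, *The Yamabe problem*, Bull. AMS 17 (1987), §6: Def. 6.2 (stereographic
projection of `M` from `P`), Def. 6.3 (asymptotically flat: `N = N₀ ∪ N_∞`, `N₀` compact,
`N_∞ ≅ ℝⁿ ∖ B_R`), and the inverted normal coordinates `z = r⁻² x` on `U − {P}` (p. 65);
Isenberg–Mazzeo–Pollack, Ann. Henri Poincaré 4 (2003) 369, Thm. 1/Thm. 4: data on `Σ ∖ {p}`, `Σ`
closed; Bartnik, CPAM 39 (1986), §1). It is the converse of the tree's end compactification
`X ∪_e {∞}` (`AFEnd.Compactification`, Bray 2001).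

* `punctureAt p : Opens M` — `M ∖ {p}` as an open submanifold;
* `PunctureEnd.radius p` (`ρ`, with `B(φ p, ρ) ⊆ φ.target`), `innerRadius p = (ρ/2)⁻¹`,
  `endSet p`, `endOpens p` — the punctured coordinate ball `U = φ⁻¹(B(φ p, ρ/2) ∖ {φ p})` in
  `M ∖ {p}`; `PunctureEnd.endChart p : U ≅ exteriorRegion (2/ρ)` — the diffeomorphism
  `x ↦ ι(φ x − φ p)`, inverse `w ↦ φ⁻¹(φ p + ι w)`;
* `AFEnd.ofPuncture p : AFEnd (punctureAt p)` — **the end of `M ∖ {p}`**, closed at infinity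
  because `{R' ≤ |w|}` is the trace of the compact shell `φ⁻¹(closed ball of radius 1/R')`;
  `AFEnd.far_ofPuncture`; `AFEnd.isSoleEnd_ofPuncture` — **for compact `M` it is the sole end**
  (the complement of a far region is `M` minus an open coordinate ball);
* `AFEnd.stdTorus3End p : AFEnd (PuncturedStdTorus 3 p)`, `AFEnd.isSoleEnd_stdTorus3End` — the
  case `M = T³` (`Literature.Geometry.Manifold.StdTorus 3`): **the punctured `3`-torus is a
  one-ended asymptotically flat topology**, the data manifold `X = T³ ∖ {p}` of the negative lane
  of the crux `MaximalCensorship` (Isenberg–Mazzeo–Pollack 2003, Thm. 4; Witt 1986).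

Everything is defined with a body and proved; no named facts. Not here: decay of any metric in
this chart (Lee–Parker (6.3)–(6.5); the IMP analysis).

## References

* J. M. Lee, T. H. Parker, *The Yamabe problem*, Bull. Amer. Math. Soc. 17 (1987) 37–91, §6,
  Defs. 6.2–6.3, p. 65. [LeeParker1987]
* J. Isenberg, R. Mazzeo, D. Pollack, *On the topology of vacuum spacetimes*, Ann. Henri Poincaré 4
  (2003) 369–383, Thm. 1, Thm. 4. [IsenbergMazzeoPollack2002]
* R. Bartnik, *The mass of an asymptotically flat manifold*, CPAM 39 (1986), §1. [Bartnik1986]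
-/

noncomputable section

open Set Function Metric TopologicalSpace EuclideanGeometry
open scoped Manifold ContDiff Topology

namespace Literature.Geometry.Lorentzian

variable {M : Type*} [TopologicalSpace M]

section Puncture

variable [T2Space M]

/-- **The punctured manifold** `M ∖ {p}` as an open submanifold of `M` (Mathlib's `Opens`
instances make it a manifold modelled on `E3`). The data manifold `Σ ∖ {p}` of
Isenberg–Mazzeo–Pollack (2003), Thm. 1. [cite: IsenbergMazzeoPollack2002, Thm. 1] -/
def punctureAt (p : M) : Opens M := ⟨{p}ᶜ, isOpen_compl_singleton⟩

/-- Membership in the punctured manifold. [folklore] -/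
@[simp] theorem mem_punctureAt_iff {p x : M} : x ∈ punctureAt p ↔ x ≠ p := Iff.rfl

end Puncture

variable [ChartedSpace E3 M]

namespace PunctureEnd

/-- **The coordinate radius `ρ` of the puncture**: a radius with `B(φ p, ρ) ⊆ φ.target` (a choice,
the chart target being an open neighbourhood of `φ p`). [folklore] -/
def radius (p : M) : ℝ :=
  Classical.choose (Metric.isOpen_iff.1 (chartAt E3 p).open_target _ (mem_chart_target E3 p))

/-- The coordinate radius is positive. [folklore] -/
theorem radius_pos (p : M) : 0 < radius p :=
  (Classical.choose_spec (Metric.isOpen_iff.1 (chartAt E3 p).open_target _ (mem_chart_target E3 p))).1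

/-- The coordinate ball of radius `ρ` lies in the chart target. [folklore] -/
theorem ball_radius_subset (p : M) : ball (chartAt E3 p p) (radius p) ⊆ (chartAt E3 p).target :=
  (Classical.choose_spec (Metric.isOpen_iff.1 (chartAt E3 p).open_target _ (mem_chart_target E3 p))).2

/-- **The inner coordinate radius `R = 2/ρ` of the end** (`ι` maps `0 < |v| < ρ/2` onto `R < |w|`). [folklore] -/
def innerRadius (p : M) : ℝ := (radius p / 2)⁻¹

/-- The inner radius is positive. [folklore] -/
theorem innerRadius_pos (p : M) : 0 < innerRadius p :=
  inv_pos.2 (half_pos (radius_pos p))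

/-- `R⁻¹ = ρ/2`. [folklore] -/
@[simp] theorem inv_innerRadius (p : M) : (innerRadius p)⁻¹ = radius p / 2 := inv_inv _

/-- `R < R'` gives `R'⁻¹ < ρ/2`. [folklore] -/
theorem inv_lt_half_radius {p : M} {R' : ℝ} (hR' : innerRadius p < R') : R'⁻¹ < radius p / 2 := by
  rw [← inv_innerRadius]
  exact inv_strictAnti₀ (innerRadius_pos p) hR'

/-- **The end set** `φ⁻¹(B(φ p, ρ/2) ∖ {φ p}) ⊆ M`, a punctured coordinate ball. [folklore] -/
def endSet (p : M) : Set M :=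
  (chartAt E3 p).source ∩ chartAt E3 p ⁻¹' (ball (chartAt E3 p p) (radius p / 2) \ {chartAt E3 p p})

/-- The end set is open. [folklore] -/
theorem isOpen_endSet (p : M) : IsOpen (endSet p) :=
  (chartAt E3 p).isOpen_inter_preimage (isOpen_ball.sdiff isClosed_singleton)

/-- Membership in the end set. [folklore] -/
theorem mem_endSet_iff {p x : M} :
    x ∈ endSet p ↔ x ∈ (chartAt E3 p).source ∧
      dist (chartAt E3 p x) (chartAt E3 p p) < radius p / 2 ∧ chartAt E3 p x ≠ chartAt E3 p p :=
  Iff.rfl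

/-- The end set misses the puncture. [folklore] -/
theorem ne_of_mem_endSet {p x : M} (hx : x ∈ endSet p) : x ≠ p := by
  rintro rfl
  exact (mem_endSet_iff.1 hx).2.2 rfl

/-- On the end set the centred coordinate `φ x − φ p` is non-zero. [folklore] -/
theorem sub_ne_zero_of_mem_endSet {p x : M} (hx : x ∈ endSet p) :
    chartAt E3 p x - chartAt E3 p p ≠ 0 :=
  sub_ne_zero.2 (mem_endSet_iff.1 hx).2.2

/-- On the end set, `0 < |φ x − φ p| < ρ/2`. [folklore] -/
theorem norm_sub_lt_of_mem_endSet {p x : M} (hx : x ∈ endSet p) :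
    ‖chartAt E3 p x - chartAt E3 p p‖ < radius p / 2 := by
  rw [← dist_eq_norm]
  exact (mem_endSet_iff.1 hx).2.1

/-- **The inverse chart of the end** read on `ℝ³`: `w ↦ φ⁻¹(φ p + ι w)` (used for `R < |w|`). [folklore] -/
def endInvBase (p : M) (w : E3) : M :=
  (chartAt E3 p).symm (chartAt E3 p p + inversion (0 : E3) 1 w)

/-- For `R < |w|`, `|ι w| < ρ/2`. [folklore] -/
theorem norm_inversion_lt_of_lt {p : M} {w : E3} (hw : innerRadius p < ‖w‖) :
    ‖inversion (0 : E3) 1 w‖ < radius p / 2 := by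
  rw [norm_inversion_zero_one, ← inv_innerRadius]
  exact inv_strictAnti₀ (innerRadius_pos p) hw

/-- For `R < |w|`, `w ≠ 0`. [folklore] -/
theorem ne_zero_of_lt {p : M} {w : E3} (hw : innerRadius p < ‖w‖) : w ≠ 0 := by
  rintro rfl
  rw [norm_zero] at hw
  exact lt_asymm hw (innerRadius_pos p)

/-- For `R < |w|`, `φ p + ι w` lies in the chart target. [folklore] -/
theorem add_inversion_mem_target {p : M} {w : E3} (hw : innerRadius p < ‖w‖) :
    chartAt E3 p p + inversion (0 : E3) 1 w ∈ (chartAt E3 p).target := by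
  refine ball_radius_subset p ?_
  rw [mem_ball, dist_eq_norm, add_sub_cancel_left]
  linarith [norm_inversion_lt_of_lt hw, radius_pos p]

/-- For `R < |w|`, `φ (φ⁻¹(φ p + ι w)) = φ p + ι w`. [folklore] -/
theorem chartAt_endInvBase {p : M} {w : E3} (hw : innerRadius p < ‖w‖) :
    chartAt E3 p (endInvBase p w) = chartAt E3 p p + inversion (0 : E3) 1 w :=
  (chartAt E3 p).right_inv (add_inversion_mem_target hw)

/-- For `R < |w|`, the inverse chart lands in the end set. [folklore] -/
theorem endInvBase_mem_endSet {p : M} {w : E3} (hw : innerRadius p < ‖w‖) :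
    endInvBase p w ∈ endSet p := by
  refine mem_endSet_iff.2 ⟨(chartAt E3 p).map_target (add_inversion_mem_target hw), ?_, ?_⟩
  · rw [chartAt_endInvBase hw, dist_eq_norm, add_sub_cancel_left]
    exact norm_inversion_lt_of_lt hw
  · rw [chartAt_endInvBase hw]
    exact fun h ↦ inversion_zero_one_ne_zero (ne_zero_of_lt hw) (add_eq_left.1 h)

section SmoothOnBase

variable [IsManifold (𝓡 3) ∞ M]

/-- `x ↦ ι(φ x − φ p)` is smooth on the end set (chart, translation, inversion off `0`). [folklore] -/
theorem contMDiffOn_inversion_chartAt_sub (p : M) :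
    ContMDiffOn (𝓡 3) (𝓡 3) ∞
      (fun x : M ↦ inversion (0 : E3) 1 (chartAt E3 p x - chartAt E3 p p)) (endSet p) := by
  have hg : ContMDiffOn (𝓡 3) (𝓡 3) ∞ (fun v : E3 ↦ inversion (0 : E3) 1 (v - chartAt E3 p p))
      {v | v ≠ chartAt E3 p p} := by
    rw [contMDiffOn_iff_contDiffOn]
    intro v hv
    exact ((contDiffAt_inversion_zero_one (n := ⊤) (sub_ne_zero.2 hv)).comp v
      (contDiffAt_id.sub contDiffAt_const)).contDiffWithinAt
  exact hg.comp (contMDiffOn_chart.mono fun x hx ↦ (mem_endSet_iff.1 hx).1)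
    fun x hx ↦ (mem_endSet_iff.1 hx).2.2

/-- `w ↦ φ⁻¹(φ p + ι w)` is smooth on `{R < |w|}` (inversion, translation, inverse chart). [folklore] -/
theorem contMDiffOn_endInvBase (p : M) :
    ContMDiffOn (𝓡 3) (𝓡 3) ∞ (endInvBase p) {w : E3 | innerRadius p < ‖w‖} := by
  have hg : ContMDiffOn (𝓡 3) (𝓡 3) ∞ (fun w : E3 ↦ chartAt E3 p p + inversion (0 : E3) 1 w)
      {w : E3 | innerRadius p < ‖w‖} := by
    rw [contMDiffOn_iff_contDiffOn]
    intro w hw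
    exact (contDiffAt_const.add (contDiffAt_inversion_zero_one (n := ⊤)
      (ne_zero_of_lt hw))).contDiffWithinAt
  exact contMDiffOn_chart_symm.comp hg fun w hw ↦ add_inversion_mem_target hw

end SmoothOnBase

variable [T2Space M]

/-- **The open set `U` of the end**: the end set inside the punctured manifold `M ∖ {p}`. [folklore] -/
def endOpens (p : M) : Opens (punctureAt p) :=
  ⟨Subtype.val ⁻¹' endSet p, (isOpen_endSet p).preimage continuous_subtype_val⟩

/-! ### The chart of the end: inversion of the centred coordinate -/

/-- **The chart of the end**, as a function: `x ↦ ι(φ x − φ p) ∈ {R < |w|}` with `ι` the unit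
inversion (`|ι v| = |v|⁻¹ > (ρ/2)⁻¹ = R`); Lee–Parker 1987, §6, p. 65 (inverted coordinates
`z = r⁻² x`). [cite: LeeParker1987, §6 p. 65] -/
def endFun (p : M) (x : endOpens p) : exteriorRegion (innerRadius p) :=
  ⟨inversion (0 : E3) 1 (chartAt E3 p ((x : punctureAt p) : M) - chartAt E3 p p), by
    rw [mem_exteriorRegion, innerRadius]
    exact lt_norm_inversion_of_norm_lt (sub_ne_zero_of_mem_endSet x.2)
      (by rw [inv_inv]; exact norm_sub_lt_of_mem_endSet x.2)⟩

/-- The value of the chart of the end. [folklore] -/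
@[simp] theorem coe_endFun (p : M) (x : endOpens p) :
    (endFun p x : E3) = inversion (0 : E3) 1 (chartAt E3 p ((x : punctureAt p) : M) - chartAt E3 p p) :=
  rfl

/-- **The inverse chart of the end** `{R < |w|} → U`, `w ↦ φ⁻¹(φ p + ι w)`. [folklore] -/
def endInv (p : M) (w : exteriorRegion (innerRadius p)) : endOpens p :=
  ⟨⟨endInvBase p w, ne_of_mem_endSet (endInvBase_mem_endSet w.2)⟩, endInvBase_mem_endSet w.2⟩

/-- The point of `M` under the inverse chart. [folklore] -/
@[simp] theorem coe_coe_endInv (p : M) (w : exteriorRegion (innerRadius p)) :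
    ((endInv p w : punctureAt p) : M) = endInvBase p w :=
  rfl

/-- `endInv ∘ endFun = id`: `φ⁻¹(φ p + ι(ι(φ x − φ p))) = φ⁻¹(φ x) = x`. [folklore] -/
theorem endInv_endFun (p : M) (x : endOpens p) : endInv p (endFun p x) = x := by
  refine Subtype.ext (Subtype.ext ?_)
  rw [coe_coe_endInv, coe_endFun, endInvBase, inversion_zero_one_inversion, add_sub_cancel]
  exact (chartAt E3 p).left_inv (mem_endSet_iff.1 x.2).1

/-- `endFun ∘ endInv = id`: `ι(φ(φ⁻¹(φ p + ι w)) − φ p) = ι(ι w) = w`. [folklore] -/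
theorem endFun_endInv (p : M) (w : exteriorRegion (innerRadius p)) : endFun p (endInv p w) = w := by
  refine Subtype.ext ?_
  rw [coe_endFun, coe_coe_endInv, chartAt_endInvBase w.2, add_sub_cancel_left,
    inversion_zero_one_inversion]

variable [IsManifold (𝓡 3) ∞ M]

/-- **The chart of the end is smooth.** [folklore] -/
theorem contMDiff_endFun (p : M) : ContMDiff (𝓡 3) (𝓡 3) ∞ (endFun p) := by
  refine (ContMDiff.subtypeVal_comp_iff _ _).1 ?_
  exact (contMDiffOn_inversion_chartAt_sub p).comp_contMDiff
    (contMDiff_subtype_val.comp contMDiff_subtype_val) fun x ↦ x.2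

/-- **The inverse chart of the end is smooth.** [folklore] -/
theorem contMDiff_endInv (p : M) : ContMDiff (𝓡 3) (𝓡 3) ∞ (endInv p) := by
  have h2 : ContMDiff (𝓡 3) (𝓡 3) ∞ (Subtype.val ∘ (Subtype.val ∘ endInv p)) :=
    (contMDiffOn_endInvBase p).comp_contMDiff contMDiff_subtype_val fun w ↦ w.2
  exact (ContMDiff.subtypeVal_comp_iff _ _).1 ((ContMDiff.subtypeVal_comp_iff _ _).1 h2)

/-- **The chart of the end as a diffeomorphism** `U ≅ {R < |w|}` (Lee–Parker 1987, §6, Def. 6.3 and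
p. 65: the structure of infinity `N_∞ ≅ ℝⁿ ∖ B_R` of `M ∖ {p}` in inverted coordinates). [cite: LeeParker1987, §6 Def. 6.3] -/
def endChart (p : M) : Diffeomorph (𝓡 3) (𝓡 3) (endOpens p) (exteriorRegion (innerRadius p)) ∞ where
  toFun := endFun p
  invFun := endInv p
  left_inv := endInv_endFun p
  right_inv := endFun_endInv p
  contMDiff_toFun := contMDiff_endFun p
  contMDiff_invFun := contMDiff_endInv p

/-- The diffeomorphism is the chart function. [folklore] -/
@[simp] theorem endChart_apply (p : M) (x : endOpens p) : endChart p x = endFun p x := rfl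

/-- A point of `M ∖ {p}` in `φ⁻¹(s)`, `s` inside a closed coordinate ball of radius `r < ρ/2` around
`φ p`, belongs to `U`, has coordinate in `s` and chart value of norm `|φ x − φ p|⁻¹`. [folklore] -/
theorem exists_eq_of_mem_image {p : M} {x : punctureAt p} {s : Set E3} {r : ℝ}
    (hs : s ⊆ closedBall (chartAt E3 p p) r) (hr : r < radius p / 2)
    (hx : (x : M) ∈ (chartAt E3 p).symm '' s) :
    ∃ u : endOpens p, (u : punctureAt p) = x ∧ chartAt E3 p (x : M) ∈ s ∧
      ‖(endChart p u : E3)‖ = ‖chartAt E3 p (x : M) - chartAt E3 p p‖⁻¹ := by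
  obtain ⟨y, hy, hyx⟩ := hx
  have hyt : y ∈ (chartAt E3 p).target := ball_radius_subset p
    (mem_ball.2 ((mem_closedBall.1 (hs hy)).trans_lt (by linarith [radius_pos p])))
  have hxs : (x : M) ∈ (chartAt E3 p).source := hyx ▸ (chartAt E3 p).map_target hyt
  have hcx : chartAt E3 p (x : M) = y := by rw [← hyx]; exact (chartAt E3 p).right_inv hyt
  have hne : y ≠ chartAt E3 p p := fun h ↦ x.2 (show (x : M) = p by
    rw [← hyx, h]; exact (chartAt E3 p).left_inv (mem_chart_source E3 p))
  have hxe : (x : M) ∈ endSet p := by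
    refine mem_endSet_iff.2 ⟨hxs, ?_, by rwa [hcx]⟩
    rw [hcx]
    exact (hs hy).trans_lt hr
  refine ⟨⟨x, hxe⟩, rfl, hcx ▸ hy, ?_⟩
  rw [endChart_apply, coe_endFun, norm_inversion_zero_one]

/-- **The coordinate shells**: for `R < R'`, the points of `U` with `R' ≤ |ι(φ x − φ p)|`, i.e.
`0 < |φ x − φ p| ≤ 1/R'`, form the trace on `M ∖ {p}` of `φ⁻¹(closed ball of radius 1/R')`. [folklore] -/
theorem image_preimage_endChart_eq (p : M) {R' : ℝ} (hR' : innerRadius p < R') :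
    ((↑) : endOpens p → punctureAt p) '' (endChart p ⁻¹' {w | R' ≤ ‖(w : E3)‖}) =
      Subtype.val ⁻¹' ((chartAt E3 p).symm '' closedBall (chartAt E3 p p) R'⁻¹) := by
  have hR'pos : 0 < R' := (innerRadius_pos p).trans hR'
  ext x
  constructor
  · rintro ⟨u, hu, rfl⟩
    have hu' : R' ≤ ‖(endFun p u : E3)‖ := hu
    rw [coe_endFun, norm_inversion_zero_one] at hu'
    refine ⟨chartAt E3 p ((u : punctureAt p) : M), ?_, (chartAt E3 p).left_inv (mem_endSet_iff.1 u.2).1⟩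
    rw [mem_closedBall, dist_eq_norm]
    exact le_inv_of_le_inv₀ hR'pos hu'
  · intro hx
    obtain ⟨u, rfl, hy, hnorm⟩ := exists_eq_of_mem_image subset_rfl (inv_lt_half_radius hR') hx
    refine ⟨u, ?_, rfl⟩
    show R' ≤ ‖(endChart p u : E3)‖
    rw [hnorm]
    rw [mem_closedBall, dist_eq_norm] at hy
    exact le_inv_of_le_inv₀ (norm_pos_iff.2 (sub_ne_zero_of_mem_endSet u.2)) hy

/-- The coordinate shells are closed in `M ∖ {p}` (the closed coordinate ball is compact). [folklore] -/
theorem isClosed_image_preimage_endChart (p : M) {R' : ℝ} (hR' : innerRadius p < R') :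
    IsClosed (((↑) : endOpens p → punctureAt p) '' (endChart p ⁻¹' {w | R' ≤ ‖(w : E3)‖})) := by
  rw [image_preimage_endChart_eq p hR']
  refine IsClosed.preimage continuous_subtype_val (IsCompact.isClosed ?_)
  refine (isCompact_closedBall _ _).image_of_continuousOn ((chartAt E3 p).continuousOn_symm.mono ?_)
  exact (closedBall_subset_ball (by linarith [inv_lt_half_radius hR', radius_pos p])).trans
    (ball_radius_subset p)

end PunctureEnd

namespace AFEnd

open PunctureEnd

variable [T2Space M] [IsManifold (𝓡 3) ∞ M]

/-- **The asymptotically flat end of the punctured manifold `M ∖ {p}`** (`M` a Hausdorff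
`3`-manifold): `U = φ⁻¹(B(φ p, ρ/2) ∖ {φ p})`, inner radius `R = 2/ρ`, structure at infinity the
inversion `x ↦ ι(φ x − φ p) : U ≅ {R < |w|}`, closed at infinity by
`isClosed_image_preimage_endChart` — the asymptotically flat structure `N_∞ ≅ ℝ³ ∖ B_R` of a
stereographic projection, Lee–Parker 1987, §6, Defs. 6.2–6.3 and p. 65. [cite: LeeParker1987, §6 Def. 6.3] -/
def ofPuncture (p : M) : AFEnd (punctureAt p) where
  U := endOpens p
  R := innerRadius p
  R_pos := innerRadius_pos p
  chart := endChart p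
  isClosed_far _ hR' := isClosed_image_preimage_endChart p hR'

/-- **The far regions of the end of the puncture are the punctured coordinate balls**:
`far R' = (M ∖ {p}) ∩ φ⁻¹(B(φ p, 1/R'))` for `R < R'`. [folklore] -/
theorem far_ofPuncture (p : M) {R' : ℝ} (hR' : innerRadius p < R') :
    (ofPuncture p).far R' = Subtype.val ⁻¹' ((chartAt E3 p).symm '' ball (chartAt E3 p p) R'⁻¹) := by
  have hR'pos : 0 < R' := (innerRadius_pos p).trans hR'
  ext x
  constructor
  · rintro ⟨u, hu, rfl⟩
    have hu' : R' < ‖(endFun p u : E3)‖ := hu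
    rw [coe_endFun, norm_inversion_zero_one] at hu'
    refine ⟨chartAt E3 p ((u : punctureAt p) : M), ?_, (chartAt E3 p).left_inv (mem_endSet_iff.1 u.2).1⟩
    rw [mem_ball, dist_eq_norm]
    exact lt_inv_of_lt_inv₀ hR'pos hu'
  · intro hx
    obtain ⟨u, rfl, hy, hnorm⟩ := exists_eq_of_mem_image ball_subset_closedBall (inv_lt_half_radius hR') hx
    refine ⟨u, ?_, rfl⟩
    show R' < ‖(endChart p u : E3)‖
    rw [hnorm]
    rw [mem_ball, dist_eq_norm] at hy
    exact lt_inv_of_lt_inv₀ (norm_pos_iff.2 (sub_ne_zero_of_mem_endSet u.2)) hy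

/-- **If `M` is compact, the end of the puncture is the sole end of `M ∖ {p}`**: the complement in
`M ∖ {p}` of `far (R + 1)` is `M` minus the open coordinate ball `φ⁻¹(B(φ p, 1/(R+1)))` (which
contains `p`), a closed subset of the compact `M` inside `M ∖ {p}` — Lee–Parker's `N = N₀ ∪ N_∞`
with `N₀` compact (1987, §6, Def. 6.3) for `M = Σ` closed. [cite: LeeParker1987, §6 Def. 6.3] -/
theorem isSoleEnd_ofPuncture [CompactSpace M] (p : M) : (ofPuncture p).IsSoleEnd := by
  have hR' : innerRadius p < innerRadius p + 1 := lt_add_one _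
  refine ⟨innerRadius p + 1, hR', ?_⟩
  have hOt : ball (chartAt E3 p p) (innerRadius p + 1)⁻¹ ⊆ (chartAt E3 p).target :=
    (ball_subset_ball (by linarith [inv_lt_half_radius hR', radius_pos p])).trans
      (ball_radius_subset p)
  have hOopen : IsOpen ((chartAt E3 p).symm '' ball (chartAt E3 p p) (innerRadius p + 1)⁻¹) :=
    (chartAt E3 p).symm.isOpen_image_of_subset_source isOpen_ball hOt
  have hpO : p ∈ (chartAt E3 p).symm '' ball (chartAt E3 p p) (innerRadius p + 1)⁻¹ :=
    ⟨chartAt E3 p p, mem_ball_self (inv_pos.2 ((innerRadius_pos p).trans hR')),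
      (chartAt E3 p).left_inv (mem_chart_source E3 p)⟩
  rw [far_ofPuncture p hR', ← preimage_compl]
  refine Topology.IsInducing.subtypeVal.isCompact_preimage' hOopen.isClosed_compl.isCompact ?_
  intro x hx
  exact ⟨⟨x, fun h ↦ hx (by rw [show x = p from h]; exact hpO)⟩, rfl⟩

/-! ### The punctured `3`-torus -/

open Literature.Geometry.Manifold in
/-- **The asymptotically flat end of the punctured standard `3`-torus `T³ ∖ {p}`** (the data
manifold `X = Σ ∖ {p}`, `Σ = T³`, of Isenberg–Mazzeo–Pollack (2003), Thm. 1/Thm. 4;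
`PuncturedStdTorus 3 p` is definitionally `punctureAt p` for `M = StdTorus 3`). [folklore] -/
def stdTorus3End (p : StdTorus 3) : AFEnd (PuncturedStdTorus 3 p) :=
  ofPuncture p

open Literature.Geometry.Manifold in
/-- **The punctured `3`-torus is one-ended**: `stdTorus3End p` is the sole end of `T³ ∖ {p}`
(`T³` is compact) — the end structure required of the data manifolds of `admissibleVacuumData X`;
what `X = T³ ∖ {p}` lacks (Isenberg–Mazzeo–Pollack 2003, Thm. 4 with Schoen–Yau 1979) is a complete
maximal asymptotically flat vacuum datum. [folklore] -/
theorem isSoleEnd_stdTorus3End (p : StdTorus 3) : (stdTorus3End p).IsSoleEnd :=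
  isSoleEnd_ofPuncture p

end AFEnd

end Literature.Geometry.Lorentzian
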